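import Mathlib
import Summits.ValiantsHypothesis.ValiantsHypothesis.Theorems.KPlusLogSqLawLiftingFiniteBaseExcess
import Summits.ValiantsHypothesis.ValiantsHypothesis.Theorems.KPlusLogSqLawStaticTridiagonalSupport

/-!
# The static tridiagonal sector at finite base: the REAL row equals the tropical row for near-tropical pencils without hidden slopes

HONEST FRAMING.  Helper file toward the lifting crux `WeakLifting` (stmt-ValiantsHypothesis-19561; registered stubs of record
`stub_tridiagonalSectorB` / `stub_tridiagonalSectorBDiag`; aside `Lifting` stmt-ValiantsHypothesis-19772) of route `KPlusLogSqLaw`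
(cell `pub-symmetroid`, seat val-sym-lift-p1 g9, 2026-08-27; desk steer R2047 (α) «TriB REAL row»).  It COMPOSES two kernel facts and
claims nothing beyond them: (1) val-sym-lift-p3's STATIC TRIDIAGONAL SECTOR LAW (`StaticTridiagonal.chain_le_of_support`: a chain of
pairwise-distinct consecutive dominant terms of a static tridiagonal design at strictly increasing integer slopes has at most
`66(m−1)(⌊log₂(m−1)⌋+2)` steps) and (2) this seat's FINITE-BASE EXACTNESS / EXCESS LAWS (`…LiftingFiniteBaseExcess`).  RESULT: for the
patchworked pencil `F_b` of a STATIC TRIDIAGONAL design (one class per band entry, nothing off the band) at any base `b ≥ N = m!·K^m`, read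
along a dominant chain whose slopes span the present slopes,
* `card_posRoots_le_static_tridiagonal_of_noHidden` — with NO hidden slopes the number of distinct positive zeros of `det F_b` is at most
  `66(m−1)(⌊log₂(m−1)⌋+2)`: in this near-tropical, hidden-slope-free sector the REAL row IS the tropical row (`O(m log m)`, no `K`);
* `card_posRoots_le_static_tridiagonal_add_hidden` — in general it is at most `66(m−1)(⌊log₂(m−1)⌋+2) + Σ_k 2·⌈H_k/2⌉`, `H_k` the hidden
  slopes (present tiling degrees strictly between consecutive chain slopes) of the `k`-th window.
CALIBRATION, HONESTLY LABELLED: as UPPER bounds both statements also follow from Descartes' rule on the support (with no hidden slopes the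
support of `det F_b` is the chain's slope set; with hidden slopes `Σ_windows Var = Var`) composed with lift-p3's chain law — the content added
here is the EQUALITY «real count = alternation count» in the hidden-slope-free sector (lower bound by intermediate values at the dominance
points) and the typed form of the reduction: for near-tropical static tridiagonal pencils the in-window REAL bound asked for by
`stub_tridiagonalSectorB` reduces to controlling the zeros born at HIDDEN tiling degrees (those within the margin of the Newton polygon's
edges, by `…LiftingFiniteBaseChordMargin`).  Far from tropical (margins below `log_b N`) the windows merge and nothing here applies — that
regime is the open content of the TriB real row.  Nothing here asserts `stub_tridiagonalSectorB`, `WeakLifting`, `TropicalB`, Conjecture B,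
`MatrixDescartes` (stmt-ValiantsHypothesis-18050) or anything about VP ≠ VNP.  No `def`.  [folklore]
-/

set_option linter.dupNamespace false
set_option autoImplicit false

namespace Summit.ValiantsHypothesis.ValiantsHypothesis.Theorems.KPlusLogSqLaw.LocalDescartes

open Polynomial Finset
open scoped BigOperators
open Summit.ValiantsHypothesis.ValiantsHypothesis.Theorems.MatrixDescartes.Negative
  (patchMatrix tropWeight termSign IsDominant)

variable {m K : ℕ}

/-- **STATIC TRIDIAGONAL REAL ROW, near-tropical and hidden-slope-free** (lift-p3's sector law ∘ finite-base exactness).  Let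
`(d, v, ε)` be a STATIC TRIDIAGONAL design (`ε i j l ≠ 0` only on the band `|i − j| ≤ 1` and only for the class `l = cls i j`, `|ε| ≤ 1`),
`b > 1` a base with `N = m!·K^m ≤ b`, and `P_0, …, P_r` terms dominant (`IsDominant`) at integer slopes `θ_0 < ⋯ < θ_r`, consecutive ones
distinct, such that every present slope lies in `[D(P_0), D(P_r)]` and none strictly between consecutive `D(P_k)`.  Then `det F_b` has at
most `66(m−1)(⌊log₂(m−1)⌋+2)` distinct positive zeros — the real count equals the alternation count (`…_of_isDominant`), which is at
most the chain length, bounded by `StaticTridiagonal.chain_le_of_support`. [folklore] -/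
theorem card_posRoots_le_static_tridiagonal_of_noHidden (b : ℝ) (d : Fin K → ℕ) (v ε : Fin m → Fin m → Fin K → ℤ)
    (cls : Fin m → Fin m → Fin K) (hε : ∀ i j l, (ε i j l).natAbs ≤ 1)
    (hstat : ∀ i j l, ε i j l ≠ 0 → (((i : ℕ) ≤ j + 1 ∧ (j : ℕ) ≤ i + 1) ∧ l = cls i j))
    (hN : (Fintype.card (Equiv.Perm (Fin m) × (Fin m → Fin K)) : ℝ) ≤ b) (hb : 1 < b)
    (r : ℕ) (θ : Fin (r + 1) → ℤ) (hθ : StrictMono θ) (P : Fin (r + 1) → Equiv.Perm (Fin m) × (Fin m → Fin K))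
    (hP : ∀ k, IsDominant d v ε (θ k) (P k)) (hne : ∀ k : Fin r, P k.castSucc ≠ P k.succ)
    (hrange : ∀ q : Equiv.Perm (Fin m) × (Fin m → Fin K), termSign ε q ≠ 0 →
      (∑ i, d ((P 0).2 i)) ≤ (∑ i, d (q.2 i)) ∧ (∑ i, d (q.2 i)) ≤ ∑ i, d ((P (Fin.last r)).2 i))
    (hno : ∀ q : Equiv.Perm (Fin m) × (Fin m → Fin K), termSign ε q ≠ 0 → ∀ k : Fin r,
      ¬ ((∑ i, d ((P k.castSucc).2 i)) < (∑ i, d (q.2 i)) ∧ (∑ i, d (q.2 i)) < ∑ i, d ((P k.succ).2 i))) :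
    (((∑ l, (X : ℝ[X]) ^ d l • (patchMatrix b v ε l).map C).det).roots.toFinset.filter (fun t => 0 < t)).card
      ≤ 66 * (m - 1) * (Nat.log 2 (m - 1) + 2) := by
  classical
  rw [card_posRoots_eq_card_alternating_of_isDominant b d v ε hε hN hb r θ hθ P hP hrange hno]
  calc (Finset.univ.filter (fun k : Fin r => termSign ε (P k.castSucc) * termSign ε (P k.succ) < 0)).card
      ≤ (Finset.univ : Finset (Fin r)).card := Finset.card_filter_le _ _
    _ = r := by rw [Finset.card_univ, Fintype.card_fin]
    _ ≤ 66 * (m - 1) * (Nat.log 2 (m - 1) + 2) := StaticTridiagonal.chain_le_of_support d v ε cls hstat r θ P hθ hP hne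

/-- **STATIC TRIDIAGONAL REAL ROW, near-tropical, with hidden slopes.**  In the setting of
`card_posRoots_le_static_tridiagonal_of_noHidden` but allowing hidden slopes, `det F_b` has at most
`66(m−1)(⌊log₂(m−1)⌋+2) + Σ_k 2·⌈H_k/2⌉` distinct positive zeros, `H_k` the number of present slopes strictly between `D(P_k)` and
`D(P_{k+1})`: for near-tropical static tridiagonal pencils the TriB real row reduces to counting hidden tiling degrees between consecutive
envelope vertices. [folklore] -/
theorem card_posRoots_le_static_tridiagonal_add_hidden (b : ℝ) (d : Fin K → ℕ) (v ε : Fin m → Fin m → Fin K → ℤ)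
    (cls : Fin m → Fin m → Fin K) (hε : ∀ i j l, (ε i j l).natAbs ≤ 1)
    (hstat : ∀ i j l, ε i j l ≠ 0 → (((i : ℕ) ≤ j + 1 ∧ (j : ℕ) ≤ i + 1) ∧ l = cls i j))
    (hN : (Fintype.card (Equiv.Perm (Fin m) × (Fin m → Fin K)) : ℝ) ≤ b) (hb : 1 < b)
    (r : ℕ) (θ : Fin (r + 1) → ℤ) (hθ : StrictMono θ) (P : Fin (r + 1) → Equiv.Perm (Fin m) × (Fin m → Fin K))
    (hP : ∀ k, IsDominant d v ε (θ k) (P k)) (hne : ∀ k : Fin r, P k.castSucc ≠ P k.succ)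
    (hrange : ∀ q : Equiv.Perm (Fin m) × (Fin m → Fin K), termSign ε q ≠ 0 →
      (∑ i, d ((P 0).2 i)) ≤ (∑ i, d (q.2 i)) ∧ (∑ i, d (q.2 i)) ≤ ∑ i, d ((P (Fin.last r)).2 i)) :
    (((∑ l, (X : ℝ[X]) ^ d l • (patchMatrix b v ε l).map C).det).roots.toFinset.filter (fun t => 0 < t)).card
      ≤ 66 * (m - 1) * (Nat.log 2 (m - 1) + 2)
        + ∑ k : Fin r, 2 * ((((Finset.Ioo (∑ i, d ((P k.castSucc).2 i)) (∑ i, d ((P k.succ).2 i))).filter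
            (fun s => ∃ q : Equiv.Perm (Fin m) × (Fin m → Fin K), termSign ε q ≠ 0 ∧ (∑ i, d (q.2 i)) = s)).card + 1) / 2) := by
  classical
  refine (card_posRoots_le_card_alternating_add_of_isDominant b d v ε hε hN hb r θ hθ P hP hrange).trans ?_
  refine Nat.add_le_add_right ?_ _
  calc (Finset.univ.filter (fun k : Fin r => termSign ε (P k.castSucc) * termSign ε (P k.succ) < 0)).card
      ≤ (Finset.univ : Finset (Fin r)).card := Finset.card_filter_le _ _
    _ = r := by rw [Finset.card_univ, Fintype.card_fin]
    _ ≤ 66 * (m - 1) * (Nat.log 2 (m - 1) + 2) := StaticTridiagonal.chain_le_of_support d v ε cls hstat r θ P hθ hP hne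

end Summit.ValiantsHypothesis.ValiantsHypothesis.Theorems.KPlusLogSqLaw.LocalDescartes
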